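import Summits.RiemannHypothesis.RiemannHypothesis.Theses.GroundBarta
import Summits.RiemannHypothesis.RiemannHypothesis.Theorems.GroundBartaPolarPerronFrobeniusConeDenseOfOneSigned
import HarnessLib

/-!
# RiemannHypothesis / GroundBarta — crux `PolarPerronFrobenius` (stmt-RiemannHypothesis-18390):
# the bottom of the CLOSED form is attained only by ground states; `GSP` without minimising sequences

Helper file (`--supports stmt-RiemannHypothesis-18390`), RH-free, Mathlib + landed tree files only, no
definitions, no named facts.  The crux and the rung speak of ground states junk-free as `L²`-limits of
`L²`-normalised minimising sequences of window tests (`IsWeilGroundState`).  Route WeilWindowFlow landed the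
closed-form inequalities: a ground state `u` has finite energy and `P(u) + 𝓔_a(u) ≤ M_a + ε(a)`
(`stub_groundStateEnergy`, C2), and every finite-energy window function has `P + 𝓔_a ≥ (M_a + ε(a))‖·‖²`
(`stub_formDomainPos`, C1).  This file proves the CONVERSE of C2, parity-free:

* `isWeilGroundState_of_energy_le` — **a finite-energy window function at the bottom of the closed form IS a
  ground state**: if `v ∈ L²` vanishes off `[-a, a]`, `∫|v|² = 1`, `ρ·D(v)` is integrable on `(0, ∞)` and
  `P(v) + 𝓔_a(v) ≤ M_a + ε(a)`, then `IsWeilGroundState a v`.  (Parity-free twin of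
  `OddSector.isWeilOddGroundState_of_energy_le`: compress by dilation — `𝓔_a(v_η) → 𝓔_a(v)`, `P(v_η) → P(v)`,
  `v_η → v` — mollify inside the freed margin with contracted increments, take a diagonal sequence,
  renormalise; the Markov decomposition `Re Q = P + 𝓔_a − M_a‖·‖²` squeezes `Re Q → ε(a)`.)
* `oneSigned_iff_exists_nonneg_formDomain_bottom` — **the sequence-free normal form of `GSP a`**: a window
  carries a one-signed ground state iff the closed windowed Weil form ATTAINS ITS INFIMUM AT A NON-NEGATIVE
  FUNCTION: `∃ v ∈ L²`, `v = 0` off `[-a, a]`, `∫|v|² = 1`, finite energy, `Im v = 0 ∧ Re v ≥ 0` a.e. on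
  `(-a, a)`, `P(v) + 𝓔_a(v) ≤ M_a + ε(a)` — Perron–Frobenius in the analyst's vocabulary, no minimising
  sequences.
* `polarPerronFrobenius_iff_formDomain` — the crux in that vocabulary.

Prover B, speedrun unit `sr-gb-rung-b` (seat 3).  References: E. Bombieri, Rend. Lincei (9) 11 (2000) §4
(Problem 2, Thm 3); M. Fukushima, Y. Oshima, M. Takeda (2011) §1.1, Ex. 1.4.1.
-/

set_option linter.dupNamespace false

noncomputable section

open MeasureTheory Complex Filter Set
open scoped Real Topology

namespace Summit.RiemannHypothesis.RiemannHypothesis.Theorems.PolarPerronFrobenius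

open Literature.NumberTheory.LFunctions
open Summit.RiemannHypothesis.RiemannHypothesis.Theses.GroundBarta
open Summit.RiemannHypothesis.RiemannHypothesis.Theorems.WeilGroundStateMarkovPart
  (exists_mollified_seq integral_norm_sq_add_le)
open Summit.RiemannHypothesis.RiemannHypothesis.Theorems.OddSector
  (memLp_weilDilate weilDilate_eq_zero_of_notMem tendsto_weilPoleForm_of_window
    tendsto_integral_norm_sq_of_tendsto_sub)
open Summit.RiemannHypothesis.RiemannHypothesis.Theorems.WeilWindowFlowWindowLipschitz
  (stub_groundStateEnergy)

/-! ### The bottom of the closed form is attained only by ground states -/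

/-- **A finite-energy window function at the bottom of the closed form is a ground state** (parity-free
converse of `stub_groundStateEnergy`).  Let `a > 0` and let `v ∈ L²` vanish off `[-a, a]`, have
`∫|v|² = 1`, integrable archimedean energy density and `P(v) + 𝓔_a(v) ≤ M_a + ε(a)`.  Then
`IsWeilGroundState a v`: `v` is the `L²`-limit of `L²`-normalised window tests with `Re Q → ε(a)` (proof in
the module docstring). [folklore] -/
theorem isWeilGroundState_of_energy_le {a : ℝ} {v : ℝ → ℂ} (ha : 0 < a) (hv : MemLp v 2)
    (hvs : ∀ x, x ∉ Icc (-a) a → v x = 0) (hvN : ∫ x, ‖v x‖ ^ 2 = (1 : ℝ))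
    (hvE : IntegrableOn (fun t ↦ weilArchDensity t * weilIncrement v t) (Ioi 0))
    (hle : weilPoleForm v + weilDirichletEnergy a v ≤ weilMarkovConstant a + weilGroundEnergy a) :
    IsWeilGroundState a v := by
  set ε : ℝ := weilGroundEnergy a with hεdef
  set M : ℝ := weilMarkovConstant a with hMdef
  -- (1) interior dilates
  set η : ℕ → ℝ := fun n ↦ 1 / ((n : ℝ) + 1) with hηdef
  have hη0 : ∀ n, 0 ≤ η n := fun n ↦ by positivity
  have hηpos : ∀ n, 0 < η n := fun n ↦ by positivity
  have hη1 : ∀ n, η n ≤ 1 := fun n ↦ by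
    rw [hηdef, div_le_one (by positivity)]; linarith [n.cast_nonneg (α := ℝ)]
  have hηm1 : ∀ n, -1 < η n := fun n ↦ by linarith [hη0 n]
  have hηlim : Tendsto η atTop (𝓝 0) := tendsto_one_div_add_atTop_nhds_zero_nat
  set f : ℕ → ℝ → ℂ := fun n ↦ weilDilate (η n) v with hfdef
  have hfm : ∀ n, MemLp (f n) 2 := fun n ↦ memLp_weilDilate hv (hηm1 n)
  have hfs : ∀ n x, x ∉ Icc (-(a / (1 + η n))) (a / (1 + η n)) → f n x = 0 := fun n x hx ↦
    weilDilate_eq_zero_of_notMem (hηm1 n) hvs hx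
  have hba : ∀ n, a / (1 + η n) < a := fun n ↦ by
    rw [div_lt_iff₀ (by linarith [hη0 n])]; nlinarith [hηpos n]
  have hfs' : ∀ n x, x ∉ Icc (-a) a → f n x = 0 := fun n x hx ↦
    hfs n x fun h ↦ hx ⟨by linarith [h.1, (hba n).le, neg_le_neg (hba n).le], h.2.trans (hba n).le⟩
  have hfN : ∀ n, ∫ x, ‖f n x‖ ^ 2 = 1 := fun n ↦ by
    rw [hfdef, integral_norm_sq_weilDilate v (hηm1 n), hvN]
  obtain ⟨hfE, hElim⟩ := tendsto_weilDirichletEnergy_weilDilate_window a ha hv hvs hvE hη0 hη1 hηlim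
  have hfL : Tendsto (fun n ↦ ∫ x, ‖f n x - v x‖ ^ 2) atTop (𝓝 0) :=
    tendsto_integral_norm_sq_weilDilate_sub_window hv hvs hη0 hη1 hηlim
  have hPlim : Tendsto (fun n ↦ weilPoleForm (f n)) atTop (𝓝 (weilPoleForm v)) :=
    tendsto_weilPoleForm_of_window hv hfm hvs hfs' hfL
  -- (2) per dilate, a mollified window test within `1/(n+1)` in mass, `L²` and pole form
  have hA : ∀ n, ∃ g : ℝ → ℂ, IsWeilTest g ∧ tsupport g ⊆ Icc (-a) a ∧
      ∫ x, ‖g x - f n x‖ ^ 2 < 1 / ((n : ℝ) + 1) ∧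
      |weilPoleForm g - weilPoleForm (f n)| < 1 / ((n : ℝ) + 1) ∧
      |(∫ x, ‖g x‖ ^ 2) - 1| < 1 / ((n : ℝ) + 1) ∧
      weilDirichletEnergy a g ≤ weilDirichletEnergy a (f n) := by
    intro n
    have hδ : (0 : ℝ) < 1 / ((n : ℝ) + 1) := by positivity
    obtain ⟨g, hgt, hgs, hgD, hgL⟩ := exists_mollified_seq (hfm n) (hfs n)
    have hgm : ∀ k, MemLp (g k) 2 := fun k ↦ (hgt k).memLp_two
    have hmargin : 0 < a - a / (1 + η n) := by linarith [hba n]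
    have hevS : ∀ᶠ k in atTop, tsupport (g k) ⊆ Icc (-a) a := by
      have : ∀ᶠ k : ℕ in atTop, 1 / ((k : ℝ) + 1) < a - a / (1 + η n) :=
        tendsto_one_div_add_atTop_nhds_zero_nat.eventually (eventually_lt_nhds hmargin)
      filter_upwards [this] with k hk
      exact (hgs k).trans (Icc_subset_Icc (by linarith) (by linarith))
    have hgs1 : ∀ k x, x ∉ Icc (-(a + 1)) (a + 1) → g k x = 0 := fun k x hx ↦
      image_eq_zero_of_notMem_tsupport fun h ↦ hx (by
        have h' := hgs k h
        have hk1 : 1 / ((k : ℝ) + 1) ≤ 1 := by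
          rw [div_le_one (by positivity)]; linarith [k.cast_nonneg (α := ℝ)]
        exact ⟨by linarith [h'.1, (hba n).le], by linarith [h'.2, (hba n).le]⟩)
    have hfs1 : ∀ x, x ∉ Icc (-(a + 1)) (a + 1) → f n x = 0 := fun x hx ↦
      hfs' n x fun h ↦ hx ⟨by linarith [h.1], by linarith [h.2]⟩
    have hNlim : Tendsto (fun k ↦ ∫ x, ‖g k x‖ ^ 2) atTop (𝓝 1) := by
      have := tendsto_integral_norm_sq_of_tendsto_sub hgm (hfm n) hgL
      rwa [hfN n] at this
    have hPg : Tendsto (fun k ↦ weilPoleForm (g k)) atTop (𝓝 (weilPoleForm (f n))) :=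
      tendsto_weilPoleForm_of_window (hfm n) hgm hfs1 hgs1 hgL
    have hev1 : ∀ᶠ k in atTop, ∫ x, ‖g k x - f n x‖ ^ 2 < 1 / ((n : ℝ) + 1) :=
      hgL.eventually (eventually_lt_nhds hδ)
    have hev2 : ∀ᶠ k in atTop, |weilPoleForm (g k) - weilPoleForm (f n)| < 1 / ((n : ℝ) + 1) := by
      have := (Metric.tendsto_nhds.1 hPg) _ hδ
      simpa only [Real.dist_eq] using this
    have hev3 : ∀ᶠ k in atTop, |(∫ x, ‖g k x‖ ^ 2) - 1| < 1 / ((n : ℝ) + 1) := by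
      have := (Metric.tendsto_nhds.1 hNlim) _ hδ
      simpa only [Real.dist_eq] using this
    obtain ⟨k, hkS, hk1, hk2, hk3⟩ := (hevS.and (hev1.and (hev2.and hev3))).exists
    exact ⟨g k, hgt k, hkS, hk1, hk2, hk3, weilDirichletEnergy_le_of_increment_le (hgD k)
      (integrableOn_weilArchDensity_mul_weilIncrement (hgt k)) (hfE n)⟩
  choose g hgt hgs hgf hgP hgN hgE using hA
  have hgm : ∀ n, MemLp (g n) 2 := fun n ↦ (hgt n).memLp_two
  have hinv : Tendsto (fun n : ℕ ↦ 1 / ((n : ℝ) + 1)) atTop (𝓝 0) :=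
    tendsto_one_div_add_atTop_nhds_zero_nat
  -- (3) masses and renormalisation
  set N : ℕ → ℝ := fun n ↦ ∫ x, ‖g n x‖ ^ 2 with hNdef
  have hN1 : ∀ n, |N n - 1| < 1 / ((n : ℝ) + 1) := hgN
  have hNpos : ∀ n, 0 < N n := fun n ↦ by
    have h1 : 1 / ((n : ℝ) + 1) ≤ 1 := by
      rw [div_le_one (by positivity)]; linarith [n.cast_nonneg (α := ℝ)]
    have h2 := (abs_lt.1 (hN1 n)).1
    linarith
  have hNlim : Tendsto N atTop (𝓝 1) := by
    have h : Tendsto (fun n ↦ N n - 1) atTop (𝓝 0) :=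
      squeeze_zero_norm (fun n ↦ (Real.norm_eq_abs _).trans_le (hN1 n).le) hinv
    simpa using h.add_const 1
  set s : ℕ → ℝ := fun n ↦ Real.sqrt (N n) with hsdef
  have hspos : ∀ n, 0 < s n := fun n ↦ Real.sqrt_pos.2 (hNpos n)
  have hssq : ∀ n, s n ^ 2 = N n := fun n ↦ Real.sq_sqrt (hNpos n).le
  set c : ℕ → ℝ := fun n ↦ (s n)⁻¹ with hcdef
  have hcpos : ∀ n, 0 < c n := fun n ↦ inv_pos.2 (hspos n)
  have hcsq : ∀ n, c n * c n = (N n)⁻¹ := fun n ↦ by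
    rw [hcdef, ← mul_inv, Real.mul_self_sqrt (hNpos n).le]
  set w : ℕ → ℝ → ℂ := fun n t ↦ (c n : ℂ) * g n t with hwdef
  have hwt : ∀ n, IsWeilTest (w n) := fun n ↦ (hgt n).const_mul (c n)
  have hws : ∀ n, tsupport (w n) ⊆ Icc (-a) a := fun n ↦ tsupport_mul_subset_right.trans (hgs n)
  have hwN : ∀ n, ∫ x, ‖w n x‖ ^ 2 = 1 := fun n ↦ by
    simp only [hwdef, norm_mul, mul_pow, Complex.norm_real, Real.norm_of_nonneg (hcpos n).le]
    rw [integral_const_mul, show c n ^ 2 = c n * c n by ring, hcsq, inv_mul_cancel₀ (hNpos n).ne']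
  have hwm : ∀ n, MemLp (w n) 2 := fun n ↦ (hwt n).memLp_two
  -- (4) energies: `ε ≤ Re Q(w n) ≤ (P(f n) + 𝓔_a(f n) + 1/(n+1))/N n − M`
  have hQw : ∀ n, (weilQuadratic (w n)).re = (N n)⁻¹ * (weilQuadratic (g n)).re := fun n ↦ by
    simp only [hwdef]
    rw [weilQuadratic_const_mul, Complex.normSq_ofReal, Complex.re_ofReal_mul, hcsq]
  have hlow : ∀ n, ε ≤ (weilQuadratic (w n)).re := fun n ↦
    weilGroundEnergy_le_of_sphere (hwt n) (hws n) (hwN n)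
  set U : ℕ → ℝ := fun n ↦
    (weilPoleForm (f n) + weilDirichletEnergy a (f n) + 1 / ((n : ℝ) + 1)) / N n - M with hUdef
  have hup : ∀ n, (weilQuadratic (w n)).re ≤ U n := fun n ↦ by
    have hMarkov := weilQuadratic_re_eq_weilPoleForm_add_weilDirichletEnergy_sub (hgt n) (hgs n)
    have hP := (abs_lt.1 (hgP n)).2
    have hQg : (weilQuadratic (g n)).re ≤
        weilPoleForm (f n) + weilDirichletEnergy a (f n) + 1 / ((n : ℝ) + 1) - M * N n := by
      rw [hMarkov]; linarith [hgE n]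
    rw [hQw n, hUdef]
    have hNi : 0 ≤ (N n)⁻¹ := inv_nonneg.2 (hNpos n).le
    calc (N n)⁻¹ * (weilQuadratic (g n)).re
        ≤ (N n)⁻¹ * (weilPoleForm (f n) + weilDirichletEnergy a (f n) + 1 / ((n : ℝ) + 1) - M * N n) :=
          mul_le_mul_of_nonneg_left hQg hNi
      _ = (weilPoleForm (f n) + weilDirichletEnergy a (f n) + 1 / ((n : ℝ) + 1)) / N n - M := by
          have hN0 : N n ≠ 0 := (hNpos n).ne'
          rw [mul_sub, ← div_eq_inv_mul, show (N n)⁻¹ * (M * N n) = M by field_simp]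
  have hUlim : Tendsto U atTop (𝓝 ((weilPoleForm v + weilDirichletEnergy a v + 0) / 1 - M)) :=
    (((hPlim.add hElim).add hinv).div hNlim one_ne_zero).sub_const M
  rw [add_zero, div_one] at hUlim
  have hLε : weilPoleForm v + weilDirichletEnergy a v - M ≤ ε := by linarith
  have hmax : Tendsto (fun n ↦ max (U n) ε) atTop (𝓝 ε) := by
    have := hUlim.max (tendsto_const_nhds (x := ε))
    rwa [max_eq_right hLε] at this
  have hQlim : Tendsto (fun n ↦ (weilQuadratic (w n)).re) atTop (𝓝 ε) :=
    tendsto_of_tendsto_of_tendsto_of_le_of_le tendsto_const_nhds hmax hlow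
      fun n ↦ (hup n).trans (le_max_left _ _)
  -- (5) `w n → v` in `L²`
  have hL : Tendsto (fun n ↦ ∫ x, ‖w n x - v x‖ ^ 2) atTop (𝓝 0) := by
    -- `∫|w n − g n|² = (1 − s n)² ≤ (1 − N n)²`
    have hwg : ∀ n, ∫ x, ‖w n x - g n x‖ ^ 2 ≤ (1 / ((n : ℝ) + 1)) ^ 2 := by
      intro n
      have e : (fun x ↦ ‖w n x - g n x‖ ^ 2) = fun x ↦ (c n - 1) ^ 2 * ‖g n x‖ ^ 2 := by
        funext x
        simp only [hwdef]
        rw [show (c n : ℂ) * g n x - g n x = ((c n - 1 : ℝ) : ℂ) * g n x by push_cast; ring,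
          norm_mul, mul_pow, Complex.norm_real, Real.norm_eq_abs, sq_abs]
      rw [e, integral_const_mul]
      have h1 : (c n - 1) ^ 2 * N n = (1 - s n) ^ 2 := by
        have hs0 : s n ≠ 0 := (hspos n).ne'
        have hc : c n = (s n)⁻¹ := rfl
        rw [hc, ← hssq n]
        field_simp
      have h2 : |1 - s n| ≤ |1 - N n| := by
        rw [← hssq n, show 1 - s n ^ 2 = (1 - s n) * (1 + s n) by ring, abs_mul]
        have : 1 ≤ |1 + s n| := by rw [abs_of_pos (by linarith [hspos n])]; linarith [hspos n]
        nlinarith [abs_nonneg (1 - s n)]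
      have h3 : |1 - N n| < 1 / ((n : ℝ) + 1) := by rw [abs_sub_comm]; exact hN1 n
      calc (c n - 1) ^ 2 * N n = |1 - s n| ^ 2 := by rw [h1, sq_abs]
        _ ≤ |1 - N n| ^ 2 := pow_le_pow_left₀ (abs_nonneg _) h2 2
        _ ≤ (1 / ((n : ℝ) + 1)) ^ 2 := pow_le_pow_left₀ (abs_nonneg _) h3.le 2
    have hbnd : ∀ n, ∫ x, ‖w n x - v x‖ ^ 2 ≤
        2 * (1 / ((n : ℝ) + 1)) ^ 2 + (4 * (1 / ((n : ℝ) + 1)) + 4 * ∫ x, ‖f n x - v x‖ ^ 2) := by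
      intro n
      have s1 := integral_norm_sq_add_le ((hwm n).sub (hgm n)) ((hgm n).sub hv)
      have e1 : (fun x ↦ ‖(w n - g n) x + (g n - v) x‖ ^ 2) = fun x ↦ ‖w n x - v x‖ ^ 2 := by
        funext x; simp only [Pi.sub_apply, sub_add_sub_cancel]
      rw [e1] at s1
      have s2 := integral_norm_sq_add_le ((hgm n).sub (hfm n)) ((hfm n).sub hv)
      have e2 : (fun x ↦ ‖(g n - f n) x + (f n - v) x‖ ^ 2) = fun x ↦ ‖(g n - v) x‖ ^ 2 := by
        funext x; simp only [Pi.sub_apply, sub_add_sub_cancel]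
      rw [e2] at s2
      simp only [Pi.sub_apply] at s1 s2 ⊢
      have h3 := hwg n
      have h4 := (hgf n).le
      linarith
    refine squeeze_zero (fun n ↦ integral_nonneg fun _ ↦ by positivity) hbnd ?_
    have h1 : Tendsto (fun n : ℕ ↦ 2 * (1 / ((n : ℝ) + 1)) ^ 2) atTop (𝓝 (2 * 0 ^ 2)) :=
      (hinv.pow 2).const_mul 2
    have h2 : Tendsto (fun n : ℕ ↦ 4 * (1 / ((n : ℝ) + 1)) + 4 * ∫ x, ‖f n x - v x‖ ^ 2) atTop
        (𝓝 (4 * 0 + 4 * 0)) := (hinv.const_mul 4).add (hfL.const_mul 4)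
    simpa using h1.add h2
  exact ⟨hv, w, fun n ↦ ⟨hwt n, hws n, hwN n⟩, hQlim, hL⟩

/-- Variant with the support hypothesis almost everywhere (truncate to the window first). [folklore] -/
theorem isWeilGroundState_of_energy_le_ae {a : ℝ} {v : ℝ → ℂ} (ha : 0 < a) (hv : MemLp v 2)
    (hvs : ∀ᵐ x : ℝ, x ∉ Icc (-a) a → v x = 0) (hvN : ∫ x, ‖v x‖ ^ 2 = (1 : ℝ))
    (hvE : IntegrableOn (fun t ↦ weilArchDensity t * weilIncrement v t) (Ioi 0))
    (hle : weilPoleForm v + weilDirichletEnergy a v ≤ weilMarkovConstant a + weilGroundEnergy a) :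
    IsWeilGroundState a v := by
  set v' : ℝ → ℂ := (Icc (-a) a).indicator v with hv'def
  have hae : v =ᵐ[volume] v' := by
    filter_upwards [hvs] with x hx
    by_cases hm : x ∈ Icc (-a) a
    · rw [hv'def, indicator_of_mem hm]
    · rw [hv'def, indicator_of_notMem hm, hx hm]
  have hv'm : MemLp v' 2 := MemLp.ae_eq hae hv
  have hv's : ∀ x, x ∉ Icc (-a) a → v' x = 0 := fun x hx ↦ indicator_of_notMem hx _
  have hN : ∫ x, ‖v' x‖ ^ 2 = 1 := by
    rw [← hvN]; exact integral_congr_ae (hae.mono fun x hx ↦ by simp only [hx])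
  have hmul : ∀ wt : ℝ → ℂ, ∫ t, v' t * wt t = ∫ t, v t * wt t := fun wt ↦
    integral_congr_ae (hae.mono fun x hx ↦ by simp only [hx])
  have hP : weilPoleForm v' = weilPoleForm v := by
    unfold weilPoleForm
    rw [hmul (fun t ↦ (Real.cosh (t / 2) : ℂ)), hmul (fun t ↦ (Real.sinh (t / 2) : ℂ))]
  have hD : weilIncrement v' = weilIncrement v := by
    funext t
    unfold weilIncrement
    refine integral_congr_ae ?_
    have h2 : (fun x ↦ v (x + t)) =ᵐ[volume] fun x ↦ v' (x + t) :=
      (measurePreserving_add_right volume t).quasiMeasurePreserving.ae_eq hae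
    filter_upwards [hae, h2] with x h1 h3
    rw [h1, h3]
  have hE' : IntegrableOn (fun t ↦ weilArchDensity t * weilIncrement v' t) (Ioi 0) := by rwa [hD]
  have hDir : weilDirichletEnergy a v' = weilDirichletEnergy a v := by
    unfold weilDirichletEnergy; rw [hD]
  have hle' : weilPoleForm v' + weilDirichletEnergy a v' ≤ weilMarkovConstant a + weilGroundEnergy a := by
    rw [hP, hDir]; exact hle
  exact (isWeilGroundState_of_energy_le ha hv'm hv's hN hE' hle').congr_ae hae.symm

/-! ### `GSP` without minimising sequences -/

/-- **The sequence-free normal form of `GSP a`**: a window `a > 0` carries a ground state of the full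
windowed Weil form that is real and `≥ 0` a.e. on `(-a, a)` iff the CLOSED form attains its infimum at a
non-negative function — some `v ∈ L²`, vanishing a.e. off `[-a, a]`, with `∫|v|² = 1`, finite archimedean
energy, `Im v = 0 ∧ 0 ≤ Re v` a.e. on `(-a, a)`, and `P(v) + 𝓔_a(v) ≤ M_a + ε(a)`. [folklore] -/
theorem oneSigned_iff_exists_nonneg_formDomain_bottom {a : ℝ} (ha : 0 < a) :
    (∃ u : ℝ → ℂ, IsWeilGroundState a u ∧ ∀ᵐ t : ℝ, t ∈ Ioo (-a) a → (u t).im = 0 ∧ 0 ≤ (u t).re) ↔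
      ∃ v : ℝ → ℂ, MemLp v 2 ∧ (∀ᵐ x : ℝ, x ∉ Icc (-a) a → v x = 0) ∧ ∫ x, ‖v x‖ ^ 2 = (1 : ℝ) ∧
        IntegrableOn (fun t ↦ weilArchDensity t * weilIncrement v t) (Ioi 0) ∧
        (∀ᵐ t : ℝ, t ∈ Ioo (-a) a → (v t).im = 0 ∧ 0 ≤ (v t).re) ∧
        weilPoleForm v + weilDirichletEnergy a v ≤ weilMarkovConstant a + weilGroundEnergy a := by
  constructor
  · rintro ⟨u, hu, hsign⟩
    obtain ⟨hE, hC2⟩ := stub_groundStateEnergy a u hu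
    rw [hu.integral_norm_sq, mul_one] at hC2
    exact ⟨u, hu.memLp, hu.ae_eq_zero_of_notMem, hu.integral_norm_sq, hE, hsign, hC2⟩
  · rintro ⟨v, hv, hvs, hvN, hvE, hsign, hle⟩
    exact ⟨v, isWeilGroundState_of_energy_le_ae ha hv hvs hvN hvE hle, hsign⟩

/-- **The crux in the analyst's vocabulary**: `PolarPerronFrobenius` iff beyond every height there is a
window at which even-winning (`ε_ev ≤ ε_od`) forces the closed windowed Weil form to attain its infimum at a
non-negative function. [folklore] -/
theorem polarPerronFrobenius_iff_formDomain :
    PolarPerronFrobenius ↔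
      ∀ A : ℝ, ∃ a : ℝ, A ≤ a ∧ (weilEvenGroundEnergy a ≤ weilOddGroundEnergy a →
        ∃ v : ℝ → ℂ, MemLp v 2 ∧ (∀ᵐ x : ℝ, x ∉ Icc (-a) a → v x = 0) ∧ ∫ x, ‖v x‖ ^ 2 = (1 : ℝ) ∧
          IntegrableOn (fun t ↦ weilArchDensity t * weilIncrement v t) (Ioi 0) ∧
          (∀ᵐ t : ℝ, t ∈ Ioo (-a) a → (v t).im = 0 ∧ 0 ≤ (v t).re) ∧
          weilPoleForm v + weilDirichletEnergy a v ≤ weilMarkovConstant a + weilGroundEnergy a) := by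
  rw [polarPerronFrobenius_iff_groundEnergy]
  constructor
  · intro h A
    obtain ⟨a, ha, hmat⟩ := h (max A 1)
    have ha0 : 0 < a := lt_of_lt_of_le one_pos ((le_max_right A 1).trans ha)
    exact ⟨a, (le_max_left A 1).trans ha, fun hle ↦
      (oneSigned_iff_exists_nonneg_formDomain_bottom ha0).1 (hmat hle)⟩
  · intro h A
    obtain ⟨a, ha, hmat⟩ := h (max A 1)
    have ha0 : 0 < a := lt_of_lt_of_le one_pos ((le_max_right A 1).trans ha)
    exact ⟨a, (le_max_left A 1).trans ha, fun hle ↦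
      (oneSigned_iff_exists_nonneg_formDomain_bottom ha0).2 (hmat hle)⟩

end Summit.RiemannHypothesis.RiemannHypothesis.Theorems.PolarPerronFrobenius

end
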